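import Mathlib.Algebra.Ring.Parity
import Mathlib.SetTheory.Cardinal.Finite
import Literature.Topology.FourManifolds.KhComplex
import Literature.Topology.FourManifolds.KhFlipReach
import Literature.Topology.FourManifolds.KhResolutionsParityProofs
import Literature.Topology.FourManifolds.KhResolutionsCircleProofs
import Literature.Topology.FourManifolds.LeeRasmussenProofs
import HarnessLib

/-!
# Labellings of state circles, free chords, and Lee's two canonical states

Sibling file of `LeeRasmussen.lean` on the way to Lee's theorem `finrank_leeHomologyZero_eq_two`
(Lee (2005), Thm. 4.2; Rasmussen (2010), Thm. 2.2, §2.3): the combinatorics of labellings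
`ℓ : Arc → Bool` of the arcs of a Gauss diagram `G` that are constant along the circles of a
state (`IsLabelOf σ ℓ`, the condition `EnhancedState.label_eq`), read through Lee's basis
`𝐚 = X + 1 ↔ false`, `𝐛 = X - 1 ↔ true`.

* `CompatAt ℓ σ i` — the labelling respects the two gluings of `σ` at chord `i`;
  **locality** `isLabelOf_iff`: `ℓ` is a labelling of `σ` iff it is compatible at every chord
  (the state graph is generated by the gluings chord by chord).
* `Free ℓ i` — all four arcs at chord `i` carry one label, i.e. `ℓ` is compatible with *both*
  smoothings at `i`; `isLabelOf_update_iff`: a labelling of `σ` is a labelling of the flipped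
  state `σ[i ↦ b]` iff `i` is free. In Lee's basis the differential of the Khovanov complex at
  `(h, t) = (0, 1)` preserves the labelling (`m(𝐚,𝐚) = 2𝐚`, `m(𝐛,𝐛) = -2𝐛`, `m(𝐚,𝐛) = 0`,
  `Δ𝐚 = 𝐚 ⊗ 𝐚`, `Δ𝐛 = 𝐛 ⊗ 𝐛`), so the complex splits along labellings `ℓ`, and the summand of
  `ℓ` is a cube over the free chords of `ℓ` (Lee (2005), §4; Rasmussen (2010), §2.3;
  Bar-Natan–Morrison (2006)).
* `IsAlternating ℓ` — the label changes at every marked point; a labelling of a state with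
  **no free chord** is alternating (`isAlternating_of_forall_not_free`), and conversely; an
  alternating labelling takes the value `ℓ(arc 0) xor (q odd)` on arc `q`
  (`IsAlternating.apply_eq_iff`), so there are exactly two of them.
* the oriented (Seifert) resolution `seifertState` (`KhResolutionsCircleProofs`) has homological
  degree `0`; under **Gauss parity** of the chords (the conclusion of
  `odd_overPos_add_underPos_of_dichotomy`, i.e. of the merge/split dichotomy) an alternating
  labelling is a labelling of exactly one state, the Seifert state
  (`isSeifert_of_isAlternating`, `compatAt_seifertState_of_isAlternating`).
* `card_noFree_degStates_zero` — consequently the enhanced states of homological degree `0`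
  whose labelling has no free chord are exactly **two**: Lee's canonical generators `𝔰_o`,
  `𝔰_ō` over the oriented resolution (Lee (2005), §4.4.3; Rasmussen (2010), §2.3), which will
  span Lee homology.

No named fact is introduced; `CompatAt`, `Free`, `IsLabelOf`, `IsAlternating` are decidable
predicates with arguments and `arcZero`, `altLabel`, `leeState` are concrete data.

## References

* E. S. Lee, *An endomorphism of the Khovanov invariant*, Adv. Math. 197 (2005) 554–586,
  §4.4 (resolution in orientation-preserving way; the generators `𝐚…𝐛`), Thm. 4.2.
  [cite: Lee2005, §4.4]
* J. Rasmussen, *Khovanov homology and the slice genus*, Invent. Math. 182 (2010) 419–447,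
  §2.3 (canonical generators `𝔰_o`), Lemma 2.4, Cor. 2.5. [cite: Rasmussen2010, §2.3]
* D. Bar-Natan, S. Morrison, *The Karoubi envelope and Lee's degeneration of Khovanov
  homology*, Algebr. Geom. Topol. 6 (2006) 1459–1469 (the splitting along `𝐚/𝐛`-colourings).
* O. Viro, Fund. Math. 184 (2004), §5 (enhanced states on Gauss diagrams). [cite: Viro2004, §5]
-/

open Function Set

noncomputable section

namespace Literature.Topology.FourManifolds

namespace GaussDiagram

variable {G : GaussDiagram}

/-! ## Labellings of a state and their locality -/

/-- `ℓ : Arc → Bool` is a **labelling of the state** `σ`: it is constant along the state circles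
of `σ`, i.e. equal on adjacent arcs of the state graph (the condition `EnhancedState.label_eq`).
Viro (2004), §5.1 (enhanced states). [cite: Viro2004, §5] -/
def IsLabelOf (σ : G.State) (ℓ : G.Arc → Bool) : Prop :=
  ∀ a b, (G.stateGraph σ).Adj a b → ℓ a = ℓ b

/-- The labelling of an enhanced state is a labelling of its state. [folklore] -/
theorem EnhancedState.isLabelOf (s : G.EnhancedState) : G.IsLabelOf s.state s.label :=
  s.label_eq

/-- A labelling of a state is constant along walks of the state graph. [folklore] -/
theorem IsLabelOf.eq_of_reachable {σ : G.State} {ℓ : G.Arc → Bool} (h : G.IsLabelOf σ ℓ)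
    {a b : G.Arc} (hab : (G.stateGraph σ).Reachable a b) : ℓ a = ℓ b := by
  obtain ⟨w⟩ := hab
  induction w with
  | nil => rfl
  | cons hadj _ ih => exact (h _ _ hadj).trans ih

/-- **Compatibility at a chord.** The labelling `ℓ` respects the two gluings of the state `σ` at
chord `i` (`o = overPos i`, `u = underPos i`): for Seifert's smoothing `arcIn o ~ arcOut u` and
`arcIn u ~ arcOut o`, otherwise `arcIn o ~ arcIn u` and `arcOut o ~ arcOut u` (cf. `stateAdj`).
It depends on `σ` only through `isSeifert σ i`. Viro (2004), §2, §5. [cite: Viro2004, §5] -/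
def CompatAt (ℓ : G.Arc → Bool) (σ : G.State) (i : Fin G.n) : Prop :=
  if G.isSeifert σ i = true then
    ℓ (G.arcIn (G.overPos i)) = ℓ (G.arcOut (G.underPos i)) ∧
      ℓ (G.arcIn (G.underPos i)) = ℓ (G.arcOut (G.overPos i))
  else
    ℓ (G.arcIn (G.overPos i)) = ℓ (G.arcIn (G.underPos i)) ∧
      ℓ (G.arcOut (G.overPos i)) = ℓ (G.arcOut (G.underPos i))

/-- Compatibility at chord `i` depends on the state only through the type of smoothing at `i`.
[folklore] -/
theorem compatAt_congr {ℓ : G.Arc → Bool} {σ τ : G.State} {i : Fin G.n}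
    (h : G.isSeifert σ i = G.isSeifert τ i) : G.CompatAt ℓ σ i ↔ G.CompatAt ℓ τ i := by
  unfold CompatAt
  rw [h]

/-- A labelling compatible at the chord through `q` is equal on every pair glued at `q`.
[folklore] -/
theorem CompatAt.eq_of_glueRel {ℓ : G.Arc → Bool} {σ : G.State} {q : Fin (2 * G.n)}
    (h : G.CompatAt ℓ σ (G.chordOf q)) {a b : G.Arc} (hab : G.glueRel σ q a b) : ℓ a = ℓ b := by
  obtain ⟨i, hq | hq⟩ := G.exists_chord q
  · subst hq
    rw [chordOf_overPos] at h
    unfold CompatAt at h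
    rcases hab with ⟨hs, h'⟩ | ⟨hs, h'⟩
    · simp only [chordOf_overPos] at hs
      rw [if_pos hs] at h
      rcases h' with ⟨rfl, rfl⟩ | ⟨rfl, rfl⟩
      · simpa using h.1
      · simpa using h.1.symm
    · simp only [chordOf_overPos] at hs
      rw [if_neg (by simp [hs])] at h
      rcases h' with ⟨rfl, rfl⟩ | ⟨rfl, rfl⟩
      · simpa using h.1
      · simpa using h.2
  · subst hq
    rw [chordOf_underPos] at h
    unfold CompatAt at h
    rcases hab with ⟨hs, h'⟩ | ⟨hs, h'⟩
    · simp only [chordOf_underPos] at hs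
      rw [if_pos hs] at h
      rcases h' with ⟨rfl, rfl⟩ | ⟨rfl, rfl⟩
      · simpa using h.2
      · simpa using h.2.symm
    · simp only [chordOf_underPos] at hs
      rw [if_neg (by simp [hs])] at h
      rcases h' with ⟨rfl, rfl⟩ | ⟨rfl, rfl⟩
      · simpa using h.1.symm
      · simpa using h.2.symm

/-- **Locality of labellings.** `ℓ` is a labelling of the state `σ` iff it is compatible with
the gluings of `σ` at every chord: the state graph is the union over the chords of the two
gluings at each chord (`stateGraph_adj`, `glueRel`). Viro (2004), §2. [cite: Viro2004, §5] -/
theorem isLabelOf_iff {σ : G.State} {ℓ : G.Arc → Bool} :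
    G.IsLabelOf σ ℓ ↔ ∀ i, G.CompatAt ℓ σ i := by
  constructor
  · intro h i
    unfold CompatAt
    split_ifs with hs
    · constructor
      · refine h.eq_of_reachable (G.reachable_of_glueRel σ (q := G.overPos i) ?_)
        exact Or.inl ⟨by simpa using hs, Or.inl ⟨rfl, by simp⟩⟩
      · refine h.eq_of_reachable (G.reachable_of_glueRel σ (q := G.underPos i) ?_)
        exact Or.inl ⟨by simpa using hs, Or.inl ⟨rfl, by simp⟩⟩
    · have hs' : G.isSeifert σ i = false := by simpa using hs
      constructor
      · refine h.eq_of_reachable (G.reachable_of_glueRel σ (q := G.overPos i) ?_)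
        exact Or.inr ⟨by simpa using hs', Or.inl ⟨rfl, by simp⟩⟩
      · refine h.eq_of_reachable (G.reachable_of_glueRel σ (q := G.overPos i) ?_)
        exact Or.inr ⟨by simpa using hs', Or.inr ⟨rfl, by simp⟩⟩
  · intro h a b hab
    obtain ⟨-, q, hq | hq⟩ := (G.stateGraph_adj σ a b).1 hab
    · exact (h (G.chordOf q)).eq_of_glueRel hq
    · exact ((h (G.chordOf q)).eq_of_glueRel hq).symm

/-! ## Free chords -/

/-- The chord `i` is **free** for the labelling `ℓ`: the four arcs at chord `i` carry one and the
same label, i.e. `ℓ` is compatible with *both* smoothings at `i` (`Free.compatAt`,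
`free_of_compatAt`). In Lee's basis these are the chords along which the summand of `ℓ` of
Lee's complex is a cube with invertible edges. Lee (2005), §4.4; Rasmussen (2010), §2.3.
[cite: Lee2005, §4.4] -/
def Free (ℓ : G.Arc → Bool) (i : Fin G.n) : Prop :=
  ℓ (G.arcOut (G.overPos i)) = ℓ (G.arcIn (G.overPos i)) ∧
    ℓ (G.arcIn (G.underPos i)) = ℓ (G.arcIn (G.overPos i)) ∧
    ℓ (G.arcOut (G.underPos i)) = ℓ (G.arcIn (G.overPos i))

/-- Freeness of a chord is decidable (three equalities of Booleans). [folklore] -/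
instance (ℓ : G.Arc → Bool) (i : Fin G.n) : Decidable (G.Free ℓ i) := by
  unfold Free; infer_instance

/-- A free chord is compatible with every smoothing. [folklore] -/
theorem Free.compatAt {ℓ : G.Arc → Bool} {i : Fin G.n} (h : G.Free ℓ i) (σ : G.State) :
    G.CompatAt ℓ σ i := by
  obtain ⟨h1, h2, h3⟩ := h
  unfold CompatAt
  split_ifs
  · exact ⟨h3.symm, h2.trans h1.symm⟩
  · exact ⟨h2.symm, h1.trans h3.symm⟩

/-- A labelling compatible with both smoothings at chord `i` is free at `i`. [folklore] -/
theorem free_of_compatAt {ℓ : G.Arc → Bool} {σ τ : G.State} {i : Fin G.n}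
    (hσ : G.CompatAt ℓ σ i) (hτ : G.CompatAt ℓ τ i) (hne : G.isSeifert σ i ≠ G.isSeifert τ i) :
    G.Free ℓ i := by
  unfold CompatAt at hσ hτ
  cases hs : G.isSeifert σ i <;> cases ht : G.isSeifert τ i <;> rw [hs, ht] at hne <;>
    simp only [hs, ht, if_true, Bool.false_eq_true, if_false] at hσ hτ
  · exact absurd rfl hne
  · exact ⟨hτ.2.symm.trans hσ.1.symm, hσ.1.symm, hτ.1.symm⟩
  · exact ⟨hσ.2.symm.trans hτ.1.symm, hτ.1.symm, hσ.1.symm⟩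
  · exact absurd rfl hne

/-- Flipping the smoothing at `i` flips the Seifert rule at `i`. [folklore] -/
theorem isSeifert_update_ne {σ : G.State} {i : Fin G.n} {b : Bool} (hb : σ i ≠ b) :
    G.isSeifert (Function.update σ i b) i ≠ G.isSeifert σ i := by
  unfold isSeifert
  rw [Function.update_self]
  revert hb
  cases σ i <;> cases b <;> cases (G.sign i == 1) <;> decide

/-- **A labelling survives a flip iff the chord is free.** If `ℓ` is a labelling of `σ`, then
`ℓ` is a labelling of the state flipped at `i` iff `i` is free for `ℓ` (locality
`isLabelOf_iff`: off `i` nothing changes, at `i` both smoothings must be respected). In Lee's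
basis: the edge `σ → σ[i ↦ 1]` of Lee's complex maps the generator `(σ, ℓ)` to a nonzero
multiple of `(σ[i ↦ 1], ℓ)` when `i` is free and to `0` otherwise. Lee (2005), §4.4;
Rasmussen (2010), §2.3. [cite: Lee2005, §4.4] -/
theorem isLabelOf_update_iff {σ : G.State} {ℓ : G.Arc → Bool} (h : G.IsLabelOf σ ℓ)
    {i : Fin G.n} {b : Bool} (hb : σ i ≠ b) :
    G.IsLabelOf (Function.update σ i b) ℓ ↔ G.Free ℓ i := by
  rw [isLabelOf_iff] at h ⊢
  constructor
  · exact fun h' ↦ free_of_compatAt (h' i) (h i) (isSeifert_update_ne hb)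
  · intro hf j
    by_cases hj : j = i
    · subst hj
      exact hf.compatAt _
    · exact (compatAt_congr (G.isSeifert_update_of_ne σ b hj)).2 (h j)

/-! ## Alternating labellings -/

/-- The labelling `ℓ` is **alternating**: the label changes at every marked point. These are
the labellings of Lee's canonical generators (adjacent arcs of the oriented resolution at a
crossing carry different labels `𝐚`, `𝐛`: Rasmussen (2010), Lemma 2.4, Cor. 2.5; Lee (2005),
§4.4.1). [cite: Rasmussen2010, Lemma 2.4] -/
def IsAlternating (ℓ : G.Arc → Bool) : Prop :=
  ∀ p : Fin (2 * G.n), ℓ (G.arcOut p) = !ℓ (G.arcIn p)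

/-- An alternating labelling has no free chord. [folklore] -/
theorem IsAlternating.not_free {ℓ : G.Arc → Bool} (h : G.IsAlternating ℓ) (i : Fin G.n) :
    ¬ G.Free ℓ i := by
  rintro ⟨h1, -, -⟩
  rw [h (G.overPos i)] at h1
  revert h1
  cases ℓ (G.arcIn (G.overPos i)) <;> decide

/-- **A labelling of a state with no free chord is alternating**: if the label did not change at
a marked point `p` of chord `i`, compatibility with the smoothing of `σ` at `i` would force all
four arcs at `i` to carry that label. Rasmussen (2010), Lemma 2.4 / Cor. 2.5 (circles of `𝔰_o`
sharing a crossing have different labels). [cite: Rasmussen2010, Lemma 2.4] -/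
theorem isAlternating_of_forall_not_free {σ : G.State} {ℓ : G.Arc → Bool} (h : G.IsLabelOf σ ℓ)
    (hf : ∀ i, ¬ G.Free ℓ i) : G.IsAlternating ℓ := by
  intro p
  obtain ⟨i, rfl | rfl⟩ := G.exists_chord p
  · have hc := isLabelOf_iff.1 h i
    have hfi := hf i
    unfold CompatAt at hc
    unfold Free at hfi
    split_ifs at hc with hs
    · obtain ⟨h1, h2⟩ := hc
      revert h1 h2 hfi
      cases ℓ (G.arcIn (G.overPos i)) <;> cases ℓ (G.arcOut (G.overPos i)) <;>
        cases ℓ (G.arcIn (G.underPos i)) <;> cases ℓ (G.arcOut (G.underPos i)) <;> decide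
    · obtain ⟨h1, h2⟩ := hc
      revert h1 h2 hfi
      cases ℓ (G.arcIn (G.overPos i)) <;> cases ℓ (G.arcOut (G.overPos i)) <;>
        cases ℓ (G.arcIn (G.underPos i)) <;> cases ℓ (G.arcOut (G.underPos i)) <;> decide
  · have hc := isLabelOf_iff.1 h i
    have hfi := hf i
    unfold CompatAt at hc
    unfold Free at hfi
    split_ifs at hc with hs
    · obtain ⟨h1, h2⟩ := hc
      revert h1 h2 hfi
      cases ℓ (G.arcIn (G.overPos i)) <;> cases ℓ (G.arcOut (G.overPos i)) <;>
        cases ℓ (G.arcIn (G.underPos i)) <;> cases ℓ (G.arcOut (G.underPos i)) <;> decide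
    · obtain ⟨h1, h2⟩ := hc
      revert h1 h2 hfi
      cases ℓ (G.arcIn (G.overPos i)) <;> cases ℓ (G.arcOut (G.overPos i)) <;>
        cases ℓ (G.arcIn (G.underPos i)) <;> cases ℓ (G.arcOut (G.underPos i)) <;> decide

/-- The diagram has at least one arc (the empty diagram has one). [folklore] -/
theorem arcCount_pos : 0 < G.arcCount := by
  unfold arcCount; omega

variable (G) in
/-- The arc number `0` (leaving the base point). [folklore] -/
def arcZero : G.Arc := ⟨0, arcCount_pos⟩

/-- **Values of an alternating labelling**: the label of arc `q` is the label of arc `0` iff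
`q` is even (induction along the arcs). [folklore] -/
theorem IsAlternating.apply_eq_iff {ℓ : G.Arc → Bool} (h : G.IsAlternating ℓ) (q : G.Arc) :
    ℓ q = ℓ G.arcZero ↔ q.val % 2 = 0 := by
  suffices H : ∀ (m : ℕ) (hm : m < G.arcCount), ℓ ⟨m, hm⟩ = ℓ G.arcZero ↔ m % 2 = 0 from
    H q.val q.isLt
  intro m
  induction m with
  | zero => intro hm; simp [arcZero]
  | succ m ih =>
    intro hm
    have h2 : m + 1 < 2 * G.n := by unfold arcCount at hm; omega
    let p : Fin (2 * G.n) := ⟨m + 1, h2⟩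
    have hout : G.arcOut p = ⟨m + 1, hm⟩ := rfl
    have hin : G.arcIn p = ⟨m, by omega⟩ := by
      apply Fin.ext
      rw [arcIn_val]
      simp [p]
    have key := h p
    rw [hout, hin] at key
    rw [key]
    have ih' := ih (by omega)
    constructor
    · intro hk
      have : ¬ (ℓ ⟨m, by omega⟩ = ℓ G.arcZero) := by
        intro he
        rw [he] at hk
        revert hk
        cases ℓ G.arcZero <;> decide
      rw [ih'] at this
      omega
    · intro hk
      have : ¬ (m % 2 = 0) := by omega
      rw [← ih'] at this
      revert this
      cases ℓ ⟨m, by omega⟩ <;> cases ℓ G.arcZero <;> decide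

/-- Two arcs have the same label under an alternating labelling iff their numbers have the same
parity. [folklore] -/
theorem IsAlternating.apply_eq_apply_iff {ℓ : G.Arc → Bool} (h : G.IsAlternating ℓ)
    (q q' : G.Arc) : ℓ q = ℓ q' ↔ q.val % 2 = q'.val % 2 := by
  have h1 := h.apply_eq_iff q
  have h2 := h.apply_eq_iff q'
  revert h1 h2
  cases ℓ q <;> cases ℓ q' <;> cases ℓ G.arcZero <;> simp <;> omega

/-- An alternating labelling is determined by its value on arc `0`. [folklore] -/
theorem IsAlternating.eq_of_apply_arcZero_eq {ℓ ℓ' : G.Arc → Bool} (h : G.IsAlternating ℓ)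
    (h' : G.IsAlternating ℓ') (h0 : ℓ G.arcZero = ℓ' G.arcZero) : ℓ = ℓ' := by
  funext q
  have h1 := h.apply_eq_iff q
  have h2 := h'.apply_eq_iff q
  revert h1 h2 h0
  cases ℓ q <;> cases ℓ' q <;> cases ℓ G.arcZero <;> cases ℓ' G.arcZero <;> simp

/-- The parity of the arc entering `p` is opposite to that of `p`. [folklore] -/
theorem arcIn_val_mod_two (p : Fin (2 * G.n)) : (G.arcIn p).val % 2 = (p.val + 1) % 2 := by
  have hp := p.isLt
  rw [arcIn_val]
  split_ifs <;> omega

variable (G) in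
/-- **The alternating labelling** with value `t` on arc `0`: arc `q` is labelled `t xor (q odd)`.
[folklore] -/
def altLabel (t : Bool) (q : G.Arc) : Bool := if q.val % 2 = 0 then t else !t

/-- `altLabel t` is alternating. [folklore] -/
theorem isAlternating_altLabel (t : Bool) : G.IsAlternating (G.altLabel t) := by
  intro p
  have h1 := G.arcIn_val_mod_two p
  unfold altLabel
  rw [arcOut_val]
  by_cases hp : p.val % 2 = 0
  · rw [if_pos hp, if_neg (by omega)]
    cases t <;> rfl
  · rw [if_neg hp, if_pos (by omega)]

/-- `altLabel t` has value `t` on arc `0`. [folklore] -/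
@[simp] theorem altLabel_arcZero (t : Bool) : G.altLabel t G.arcZero = t := by
  simp [altLabel, arcZero]

/-! ## The Seifert state and Gauss parity -/

/-- A state all of whose smoothings are Seifert's is the Seifert state `seifertState`
(`KhResolutionsCircleProofs`). [folklore] -/
theorem eq_seifertState_of_forall {σ : G.State} (h : ∀ i, G.isSeifert σ i = true) :
    σ = G.seifertState := by
  funext i
  have hi := h i
  unfold isSeifert at hi
  unfold seifertState
  revert hi
  cases σ i <;> cases (G.sign i == 1) <;> decide

/-- Under Gauss parity at chord `i`, an alternating labelling of a state forces Seifert's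
smoothing at `i`: the arcs entering the two passages have numbers of the parities of `o + 1`
and `u + 1`, hence different labels, which the non-Seifert gluing `arcIn o ~ arcIn u` forbids.
Lee (2005), §4.4.1 (the canonical states live over the oriented resolution). [cite: Lee2005, §4.4] -/
theorem isSeifert_of_isAlternating {σ : G.State} {ℓ : G.Arc → Bool} (hℓ : G.IsLabelOf σ ℓ)
    (ha : G.IsAlternating ℓ) {i : Fin G.n}
    (hpar : (G.overPos i).val % 2 ≠ (G.underPos i).val % 2) : G.isSeifert σ i = true := by
  by_contra hs
  have hc := isLabelOf_iff.1 hℓ i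
  unfold CompatAt at hc
  rw [if_neg hs] at hc
  have h1 := (ha.apply_eq_apply_iff _ _).1 hc.1
  rw [arcIn_val_mod_two, arcIn_val_mod_two] at h1
  omega

/-- Under Gauss parity at chord `i`, an alternating labelling is compatible with Seifert's
smoothing at `i`. [cite: Lee2005, §4.4] -/
theorem compatAt_seifertState_of_isAlternating {ℓ : G.Arc → Bool} (ha : G.IsAlternating ℓ)
    {i : Fin G.n} (hpar : (G.overPos i).val % 2 ≠ (G.underPos i).val % 2) :
    G.CompatAt ℓ G.seifertState i := by
  unfold CompatAt
  rw [if_pos (G.isSeifert_seifertState i)]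
  have h1 : ℓ (G.arcIn (G.overPos i)) ≠ ℓ (G.arcIn (G.underPos i)) := by
    rw [Ne, ha.apply_eq_apply_iff, arcIn_val_mod_two, arcIn_val_mod_two]
    omega
  have h2 := ha (G.overPos i)
  have h3 := ha (G.underPos i)
  revert h1 h2 h3
  cases ℓ (G.arcIn (G.overPos i)) <;> cases ℓ (G.arcIn (G.underPos i)) <;>
    cases ℓ (G.arcOut (G.overPos i)) <;> cases ℓ (G.arcOut (G.underPos i)) <;> decide

/-! ## Lee's two canonical states -/

variable (G) in
/-- **Lee's canonical state** with label `t` on arc `0`: the Seifert (oriented) resolution with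
the alternating labelling `altLabel t`, an enhanced state when the chords satisfy Gauss parity.
Lee (2005), §4.4.3; Rasmussen (2010), §2.3 (`𝔰_o`, `𝔰_ō`). [cite: Rasmussen2010, §2.3] -/
def leeState (hpar : ∀ i, (G.overPos i).val % 2 ≠ (G.underPos i).val % 2) (t : Bool) :
    G.EnhancedState where
  state := G.seifertState
  label := G.altLabel t
  label_eq := isLabelOf_iff.2 fun i ↦
    compatAt_seifertState_of_isAlternating (isAlternating_altLabel t) (hpar i)

/-- Lee's canonical states have homological degree `0`. [cite: Rasmussen2010, §2.3] -/
theorem homDegree_leeState (hpar : ∀ i, (G.overPos i).val % 2 ≠ (G.underPos i).val % 2)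
    (t : Bool) : homDegree (G.leeState hpar t) = 0 := by
  simp [homDegree, leeState, weight_seifertState]

/-- **Exactly two degree-zero enhanced states have no free chord** (under Gauss parity of the
chords, e.g. for diagrams satisfying the merge/split dichotomy,
`overPos_mod_two_ne_of_dichotomy`): they are Lee's canonical states `leeState hpar t`,
`t = false, true` — a labelling with no free chord is alternating, an alternating labelling is
one of the two `altLabel t` and lives over the Seifert state only. These will be shown to span
Lee homology `Kh'⁰` (Lee (2005), Thm. 4.2: `Kh'(K) ≅ ℚ ⊕ ℚ` generated by the states of the two
orientations; Rasmussen (2010), Thm. 2.2, §2.3). [cite: Lee2005, Thm. 4.2] -/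
theorem card_noFree_degStates_zero
    (hpar : ∀ i, (G.overPos i).val % 2 ≠ (G.underPos i).val % 2) :
    Nat.card {s : G.degStates 0 // ∀ i, ¬ G.Free s.1.label i} = 2 := by
  classical
  let e : {s : G.degStates 0 // ∀ i, ¬ G.Free s.1.label i} ≃ Bool :=
    { toFun := fun s ↦ s.1.1.label G.arcZero
      invFun := fun t ↦ ⟨⟨G.leeState hpar t, homDegree_leeState hpar t⟩,
        (isAlternating_altLabel t).not_free⟩
      left_inv := by
        rintro ⟨⟨s, hs⟩, hf⟩
        have ha : G.IsAlternating s.label := isAlternating_of_forall_not_free s.isLabelOf hf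
        apply Subtype.ext; apply Subtype.ext
        refine EnhancedState.ext' ?_ ?_
        · exact (eq_seifertState_of_forall fun i ↦
            isSeifert_of_isAlternating s.isLabelOf ha (hpar i)).symm
        · exact (isAlternating_altLabel _).eq_of_apply_arcZero_eq ha (altLabel_arcZero _)
      right_inv := fun t ↦ altLabel_arcZero (G := G) t }
  rw [Nat.card_congr e, Nat.card_eq_fintype_card, Fintype.card_bool]

end GaussDiagram

end Literature.Topology.FourManifolds
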